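import Summits.AtomisticToContinuum.Crystallization.Theorems.FrustratedLawDichotomyStrainedPatchHomValueT2SoundH
import Summits.AtomisticToContinuum.Crystallization.Theorems.FrustratedLawDichotomyStrainedPatchHomValueT2KitL

/-!
# G5′ lane edition (α): the value floor at the centre point with a PARAMETRISED bisection window, and the `W` reports
# (27623 `(H) HomFloor`, hcp half; decomp-a2c hand-1 g48 — critic rows 1652 (α) / 1655 (α) / 1657 (C) / 1659 (C)(1): «kernel literal 2⁴⁴ in the landed
# `…HomValueT2Kit.valueP` ⇒ `valuePW (win) (n)` + `t2ReportLW` lane EDITION under a GO; soundness shape unchanged because `bisectUp` only returns PASSED targets»)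

The landed `valueP μ c` searches the value floor `V₀ ≤ E(U_c, ξ_c)·SC` by bisection in the FIXED window `[μ − 2⁴⁴, μ + 2⁴⁴]` (30 steps), so `V₀ − μ` saturates at
`2⁴⁴/SC ≡ 19.53 m` on every far frame (census LOEW49 §4: the PASS* projection of the far value leaf's ball-cover price 1.39e4 core-h is conditional on this fix).
This module is the edition: NO landed declaration is touched —
* §1 `valuePW win n μ c` (window `[μ − win, μ + win]`, `n` steps), `valuePW_two44 : valuePW 2⁴⁴ 30 = valueP` (definitional), `tableLeaf_of_valuePW`, and
  ★ `valuePW_sound` — VERBATIM the statement of the landed `valueP_sound` (the bisection invariant `bisectUp_true` is window-agnostic);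
* §2 the reports `t2ReportLW win n` / `t2ReportJW win n` (= the landed `t2ReportL` / `t2ReportJ` with `valuePW win n` in place of `valueP`; every other line
  byte-identical) and the verdicts `valueLeafT2LW` / `valueLeafT2JW`; `t2ReportLW_two44 : t2ReportLW 2⁴⁴ 30 = t2ReportL` etc. (definitional).
Census usage: `win := 2⁴⁸` (= 1 in `SC` units ≡ 312 m), `n := 34` keeps the landed resolution `2⁴⁵/2³⁰ = 2¹⁵` (`2⁴⁹/2³⁴`).

0 sorry; standard axioms; no instances / notation / `#eval`.  `--supports stmt-AtomisticToContinuum-27623`.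
-/

namespace Summit.AtomisticToContinuum.Crystallization.Theorems.FrustratedLawDichotomyStrainedPatchHomValueT2Kit

open scoped BigOperators
open Literature.Analysis.ValidatedNumerics.Numerics
open Summit.AtomisticToContinuum.Crystallization.Theorems.FrustratedLawDichotomySchurCut (effPot w₄₅ ω₄)
open Summit.AtomisticToContinuum.Crystallization.Theorems.FrustratedLawDichotomyStrainedPatchHomSplit (latPt hexFrame hcpShift)
open Summit.AtomisticToContinuum.Crystallization.Theorems.FrustratedLawDichotomyStrainedPatchHomEntryGram (cen rad)
open Summit.AtomisticToContinuum.Crystallization.Theorems.FrustratedLawDichotomyStrainedPatchHomCurvCentreKit (cenMap cenShuf zW)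
open Summit.AtomisticToContinuum.Crystallization.Theorems.FrustratedLawDichotomyStrainedPatchHomLeafTableCheckHcpV (tableLeafOKHV)
open Summit.AtomisticToContinuum.Crystallization.Theorems.FrustratedLawDichotomyStrainedPatchHomLeafTableCheck (qTableK1 tabE)

/-! ## §1. The windowed value floor at the centre point -/

/-- ★ **Value floor at the centre POINT with a parametrised window**: bisection of the vector-form table leaf of record on the zero-width box in
`[μ − win, μ + win]`, `n` steps; `none` if even `μ − win` fails.  `valueP = valuePW 2⁴⁴ 30`. -/
def valuePW (win : ℤ) (n : ℕ) (μ : ℤ) (c : (Fin 3 × Fin 3) ⊕ Fin 3 → ℤ) : Option ℤ :=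
  let f : ℤ → Bool := fun m => tableLeafOKHV qTableK1 tabE m c zW
  let lo := μ - win
  if f lo then some (bisectUp f lo (μ + win) n) else none

/-- The landed `valueP` is the edition at window `2⁴⁴`, 30 steps. [formal bookkeeping] -/
theorem valuePW_two44 (μ : ℤ) (c : (Fin 3 × Fin 3) ⊕ Fin 3 → ℤ) : valuePW 17592186044416 30 μ c = valueP μ c := rfl

/-- `valuePW win n μ c = some v` ⟹ the table leaf passes at target `v` on the zero-width box. [formal bookkeeping] -/
theorem tableLeaf_of_valuePW {win : ℤ} {n : ℕ} {μ : ℤ} {c : (Fin 3 × Fin 3) ⊕ Fin 3 → ℤ} {v : ℤ} (h : valuePW win n μ c = some v) :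
    tableLeafOKHV qTableK1 tabE v c zW = true := by
  unfold valuePW at h
  dsimp only at h
  split at h
  · rename_i hlo
    cases h
    exact bisectUp_true (fun m => tableLeafOKHV qTableK1 tabE m c zW) n (μ - win) (μ + win) hlo
  · exact absurd h (by simp)

/-- The bisection never returns below its start: `a ≤ b ⟹ a ≤ bisectUp f a b k`. [formal bookkeeping] -/
theorem bisectUp_start_le (f : ℤ → Bool) : ∀ (k : ℕ) (a b : ℤ), a ≤ b → a ≤ bisectUp f a b k := by
  intro k
  induction k with
  | zero => intro a b _; simp [bisectUp]
  | succ k ih =>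
    intro a b hab
    simp only [bisectUp]
    split_ifs with hmid
    · exact le_trans (by omega) (ih _ _ (by omega))
    · exact ih _ _ (by omega)

/-- ★ The landed `valueP_sound` with its hypothesis weakened to the TABLE-LEAF PASS at `v` (window-agnostic): re-run the landed search from `μ := v + 2⁴⁴`
(its start `v` passes), take the landed floor at the output `v⋆`, and `v ≤ v⋆` by `bisectUp_start_le`. [formal bookkeeping] -/
theorem valueP_sound_of_tableLeaf {c : (Fin 3 × Fin 3) ⊕ Fin 3 → ℤ} {v : ℤ} (htab : tableLeafOKHV qTableK1 tabE v c zW = true)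
    (hU : ‖cenMap c - 1‖ ≤ 1 / 4) :
    (v : ℝ) / SC ≤ (∑ b ∈ (Fintype.piFinset fun _ : Fin 3 => Finset.Icc (-7 : ℤ) 7).filter (fun b => b ≠ 0), effPot w₄₅ ω₄ (3 / 400) ‖latPt (cenMap c) hexFrame b‖) +
      ∑ b ∈ (Fintype.piFinset fun _ : Fin 3 => Finset.Icc (-7 : ℤ) 7), effPot w₄₅ ω₄ (3 / 400) ‖latPt (cenMap c) hexFrame b + (cenMap c) (hcpShift + cenShuf c)‖ := by
  have hval : valueP (v + 17592186044416) c =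
      some (bisectUp (fun m => tableLeafOKHV qTableK1 tabE m c zW) v (v + 17592186044416 + 17592186044416) 30) := by
    unfold valueP
    dsimp only
    rw [show v + 17592186044416 - 17592186044416 = v by ring, if_pos htab]
  have key := valueP_sound hval hU
  have hS : (0 : ℝ) < SC := by norm_num [SC]
  have hle : (v : ℝ) ≤ (bisectUp (fun m => tableLeafOKHV qTableK1 tabE m c zW) v (v + 17592186044416 + 17592186044416) 30 : ℤ) := by
    exact_mod_cast bisectUp_start_le _ 30 _ _ (by omega)
  exact (div_le_div_of_nonneg_right hle hS.le).trans key

/-- ★★ **VALUE AT THE CENTRE, windowed edition**: if `valuePW win n μ c = some v` and the centre self-map is within `1/4` of the identity, then `v/SC` is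
below the full two-family `hver` energy at `(U_c, ξ_c) = (cenMap c, cenShuf c)` — VERBATIM the conclusion of the landed `valueP_sound`, for ANY window and
step count. [formal bookkeeping: `tableLeaf_of_valuePW` + `valueP_sound_of_tableLeaf`] -/
theorem valuePW_sound {win : ℤ} {n : ℕ} {μ : ℤ} {c : (Fin 3 × Fin 3) ⊕ Fin 3 → ℤ} {v : ℤ} (h : valuePW win n μ c = some v)
    (hU : ‖cenMap c - 1‖ ≤ 1 / 4) :
    (v : ℝ) / SC ≤ (∑ b ∈ (Fintype.piFinset fun _ : Fin 3 => Finset.Icc (-7 : ℤ) 7).filter (fun b => b ≠ 0), effPot w₄₅ ω₄ (3 / 400) ‖latPt (cenMap c) hexFrame b‖) +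
      ∑ b ∈ (Fintype.piFinset fun _ : Fin 3 => Finset.Icc (-7 : ℤ) 7), effPot w₄₅ ω₄ (3 / 400) ‖latPt (cenMap c) hexFrame b + (cenMap c) (hcpShift + cenShuf c)‖ :=
  valueP_sound_of_tableLeaf (tableLeaf_of_valuePW h) hU

/-! ## §2. The windowed reports and verdicts (every line = the landed `t2ReportL` / `t2ReportJ` with `valuePW win n` in place of `valueP`) -/

/-- ★★ **Second-edition report, windowed** `(flag, V₀ − μ, boxMin, penP, penL, pen0, κ, LB − μ)` in `SC` units. -/
def t2ReportLW (win : ℤ) (n : ℕ) (μ : ℤ) (c w : (Fin 3 × Fin 3) ⊕ Fin 3 → ℤ) : Bool × ℤ × ℤ × ℤ × ℤ × ℤ × ℤ × ℤ :=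
  let LA := nearA c w
  let LB := nearB c w
  let wf : Array ℤ := Array.ofFn fun p : Fin 9 => foldW w p
  let PA := passAll c w wf LA LB
  let P := PA.1
  let A := PA.2
  let Hc : Array ℤ := P.H.map cen
  let Hr : Array ℤ := P.H.map rad
  let gc : Array ℤ := P.g.map cen
  let gr : Array ℤ := P.g.map rad
  match valuePW win n μ c, kappaShift Hc with
  | some v, some κ =>
    let t := anchor Hc gc wf 40
    let bm := boxMin Hc gc wf κ t
    let pP : ℤ := cdiv ((List.range 9).foldl (fun s k => s + gr.getD k 0 * wf.getD k 0) 0) (SC : ℤ) +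
      cdiv ((List.range 9).foldl (fun s k => (List.range 9).foldl (fun s2 l => s2 + (Hr.getD (9 * k + l) 0) * wf.getD k 0 * wf.getD l 0) s) 0)
        (2 * (SC : ℤ) * (SC : ℤ))
    let pL : ℤ := cdiv A.pen6 (6 * (SC : ℤ) * (SC : ℤ))
    let p0 : ℤ := cdiv A.pen0 (2 * (SC : ℤ) * (SC : ℤ))
    (foldGuard c w && P.ok && A.ok && symOK Hc, v - μ, bm, pP, pL, p0, κ, v + bm - pP - pL - p0 - μ)
  | some v, none => (false, v - μ, 0, 0, 0, 0, -1, 0)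
  | none, _ => (false, 0, 0, 0, 0, 0, 0, 0)

/-- ★★★ **Second-edition verdict, windowed.** -/
def valueLeafT2LW (win : ℤ) (n : ℕ) (μ : ℤ) (c w : (Fin 3 × Fin 3) ⊕ Fin 3 → ℤ) : Bool :=
  let r := t2ReportLW win n μ c w
  r.1 && decide (0 ≤ r.2.2.2.2.2.2.2)

/-- ★★ **Third-edition (joint segment) report, windowed** `(flag, V₀ − μ, boxMin, penP, penJ, pen0, κ, LB − μ)` in `SC` units. -/
def t2ReportJW (win : ℤ) (n : ℕ) (μ : ℤ) (c w : (Fin 3 × Fin 3) ⊕ Fin 3 → ℤ) : Bool × ℤ × ℤ × ℤ × ℤ × ℤ × ℤ × ℤ :=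
  let LA := nearA c w
  let LB := nearB c w
  let wf : Array ℤ := Array.ofFn fun p : Fin 9 => foldW w p
  let P := passP c LA LB
  let Hc : Array ℤ := P.H.map cen
  let Hr : Array ℤ := P.H.map rad
  let gc : Array ℤ := P.g.map cen
  let gr : Array ℤ := P.g.map rad
  let A := passJ c w wf LA LB
  match valuePW win n μ c, kappaShift Hc with
  | some v, some κ =>
    let t := anchor Hc gc wf 40
    let bm := boxMin Hc gc wf κ t
    let pP : ℤ := cdiv ((List.range 9).foldl (fun s k => s + gr.getD k 0 * wf.getD k 0) 0) (SC : ℤ) +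
      cdiv ((List.range 9).foldl (fun s k => (List.range 9).foldl (fun s2 l => s2 + (Hr.getD (9 * k + l) 0) * wf.getD k 0 * wf.getD l 0) s) 0)
        (2 * (SC : ℤ) * (SC : ℤ))
    let pL : ℤ := cdiv A.pen6 (6 * (SC : ℤ) * (SC : ℤ))
    let p0 : ℤ := cdiv A.pen0 (2 * (SC : ℤ) * (SC : ℤ))
    (foldGuard c w && P.ok && A.ok && symOK Hc, v - μ, bm, pP, pL, p0, κ, v + bm - pP - pL - p0 - μ)
  | some v, none => (false, v - μ, 0, 0, 0, 0, -1, 0)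
  | none, _ => (false, 0, 0, 0, 0, 0, 0, 0)

/-- ★★★ **Third-edition verdict, windowed.** -/
def valueLeafT2JW (win : ℤ) (n : ℕ) (μ : ℤ) (c w : (Fin 3 × Fin 3) ⊕ Fin 3 → ℤ) : Bool :=
  let r := t2ReportJW win n μ c w
  r.1 && decide (0 ≤ r.2.2.2.2.2.2.2)

/-- The landed second-edition report is the windowed one at `(2⁴⁴, 30)`. [formal bookkeeping] -/
theorem t2ReportLW_two44 (μ : ℤ) (c w : (Fin 3 × Fin 3) ⊕ Fin 3 → ℤ) : t2ReportLW 17592186044416 30 μ c w = t2ReportL μ c w := rfl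

/-- The landed third-edition report is the windowed one at `(2⁴⁴, 30)`. [formal bookkeeping] -/
theorem t2ReportJW_two44 (μ : ℤ) (c w : (Fin 3 × Fin 3) ⊕ Fin 3 → ℤ) : t2ReportJW 17592186044416 30 μ c w = t2ReportJ μ c w := rfl

/-- The landed verdicts are the windowed ones at `(2⁴⁴, 30)`. [formal bookkeeping] -/
theorem valueLeafT2LW_two44 (μ : ℤ) (c w : (Fin 3 × Fin 3) ⊕ Fin 3 → ℤ) :
    valueLeafT2LW 17592186044416 30 μ c w = valueLeafT2L μ c w ∧ valueLeafT2JW 17592186044416 30 μ c w = valueLeafT2J μ c w := ⟨rfl, rfl⟩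

end Summit.AtomisticToContinuum.Crystallization.Theorems.FrustratedLawDichotomyStrainedPatchHomValueT2Kit
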